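import Literature.AnabelianGeometry.EtaleTheta.ThetaSystems

/-!
# Cor 2.19 (iii), second half: the induced projective system of bi-theta environments ([EtTh] §2, p.65)

Mochizuki, *The Étale Theta Function …* [EtTh], Publ. RIMS 45 (2009), Cor 2.19 (iii), PRIMS text p.65
(bib key `MochizukiEtTh2009`): "by taking a compatible system of members of the above collections of
classes associated to the [`Π•_X` arising, as in Corollary 2.18 (iii), from the] `M•_M`, applying the
isomorphisms of cyclotomes of (i), and adding the resulting classes to the [theta] sections of each
`M•_M`, one obtains a projective system of bi-theta environments … isomorphic to some natural projective
system of bi-theta environments [of standard type]".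

Typed over `ThetaEnvTower` for the NATURAL mono-theta system (to which Cor 2.19 (ii) reduces a general
system): the chosen members differ from the theta cocycles `η_M` by a compatible continuous inflated
`G_K`-cocycle family `c_M` (first half, `ThetaEnvTower.Cor219_iii`); the bi-theta environments
`B•_M = (Π_Y[μ_M], D_Y, [s^Θ_{η_M}], [s^alg · c_M])` are compared with the natural bi-theta environments of
the twisted family `η_M · c_M` (a "multiple by an `l`-th root of unity" of the original collection, Cor 2.8 (i)).
Statement shape per the audits of abc-iut-L2-d1 (INBOX 20:10:58Z) and abc-iut-L6-t23 (19:43:02Z).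
-/

namespace Literature.AnabelianGeometry.EtaleTheta

namespace ThetaEnvTower

universe u

variable {E : Set ℕ+} (T : ThetaEnvTower.{u} E)

/-- The algebraic section twisted by an inflated `G_K`-cocycle `c`: `g ↦ (c(aug g), g)` — the second
section of the bi-theta environments of Cor 2.19 (iii). [cite: MochizukiEtTh2009, Cor 2.19(iii) p.65] -/
def twistedAlg (M : E) {c : T.G → T.mu M}
    (hc : CycEnvelope.IsEnvCocycle (MonoidHom.id T.G) (T.chi M) c) : T.PiYdd →* (T.level M).env where
  toFun g := ⟨c (T.aug g), (T.level M).inclYdd g⟩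
  map_one' := by
    have h1 : c 1 = 1 := by
      have := hc 1 1
      simp only [mul_one, map_one, MulAut.one_apply] at this
      exact mul_eq_left.mp this.symm
    ext <;> simp [h1]
  map_mul' g h := by
    ext
    · simp only [Subgroup.coe_mul, map_mul, SemidirectProduct.mul_left, MonoidHom.coe_comp,
        Function.comp_apply]
      exact hc _ _
    · simp

/-- The section `g ↦ (η(g)⁻¹, g)` of `Π_Y[μ_M] ↠ Π_Y` over `Π_Ÿ` attached to ANY `μ_M`-valued 1-cocycle
`η` of `Π^tp_Ÿ` (for `η` in the collection this is `ThetaEnvData.sTheta`; here used for the `μ_l`-twisted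
cocycles `η_M · c_M`, which need not lie in the collection). [cite: MochizukiEtTh2009, Cor 2.19(iii) p.65] -/
def sectionOf (M : E) (η : T.PiYdd → T.mu M)
    (hη : CycEnvelope.IsEnvCocycle (T.aug.comp T.PiYdd.subtype) (T.chi M) η) :
    T.PiYdd →* (T.level M).env where
  toFun g := ⟨(η g)⁻¹, (T.level M).inclYdd g⟩
  map_one' := by
    have h1 : η 1 = 1 := by
      have := hη 1 1
      simp only [mul_one, map_one, MulAut.one_apply] at this
      exact mul_eq_left.mp this.symm
    ext <;> simp [h1]
  map_mul' g h := by
    have hc := hη g h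
    ext
    · simp only [SemidirectProduct.mul_left, MonoidHom.coe_comp, Function.comp_apply, hc,
        mul_inv_rev, map_inv]
      rw [mul_comm]
      rfl
    · simp

/-- The product of a cocycle of `Π^tp_Ÿ` with an inflated `G_K`-cocycle is a cocycle.
[cite: MochizukiEtTh2009, Cor 2.19(iii) p.65] -/
theorem isEnvCocycle_mul_inflate (M : E) {η : T.PiYdd → T.mu M} {c : T.G → T.mu M}
    (hη : CycEnvelope.IsEnvCocycle (T.aug.comp T.PiYdd.subtype) (T.chi M) η)
    (hc : CycEnvelope.IsEnvCocycle (MonoidHom.id T.G) (T.chi M) c) :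
    CycEnvelope.IsEnvCocycle (T.aug.comp T.PiYdd.subtype) (T.chi M)
      (η * (c ∘ T.aug ∘ T.PiYdd.subtype)) := by
  intro g h
  have h1 := hη g h
  have h2 := hc (T.aug g) (T.aug h)
  simp only [Pi.mul_apply, Function.comp_apply, Subgroup.coe_subtype, Subgroup.coe_mul, map_mul,
    MonoidHom.coe_comp, MonoidHom.id_apply] at h1 h2 ⊢
  rw [h1, h2]
  simp only [mul_assoc, mul_left_comm, mul_comm]

/-- **Corollary 2.19 (iii)**, second half, for the NATURAL projective system of mono-theta environments
(compatible theta cocycles `η_M`, transitions = reductions): for a compatible inflated CONTINUOUS family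
`c_M` (the "multiple" of the first half; in print an `l`-th root of unity — not needed here), the bi-theta
environments `B•_M = (Π_Y[μ_M], D_Y, [s^Θ_{η_M}], [s^alg·c_M])` obtained by "adding the classes to the theta
sections" form a projective system ISOMORPHIC, compatibly with the reductions, to the natural projective
system of bi-theta environments `(Π_Y[μ_M], D_Y, [s^Θ_{η_M c_M}], [s^alg])` of the twisted collection.
[cite: MochizukiEtTh2009, Cor 2.19(iii) p.65] -/
def Cor219_iii_systems : Prop :=
  ∀ (η : ∀ M : E, T.PiYdd → T.mu M) (hη : ∀ M, η M ∈ T.thetaCocycles M)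
    (_ : ∀ (M M' : E) (h : (M : ℕ+) ∣ M'), T.red M M' h ∘ η M' = η M)
    (c : ∀ M : E, T.G → T.mu M)
    (hc : ∀ M, CycEnvelope.IsEnvCocycle (MonoidHom.id T.G) (T.chi M) (c M))
    (_ : ∀ M, IsLocallyConstant (c M ∘ T.aug))
    (_ : ∀ (M M' : E) (h : (M : ℕ+) ∣ M'), T.red M M' h ∘ c M' = c M),
    ∃ α : ∀ M : E, BiThetaEnv.Iso
        { Pi := (T.level M).env, D := (T.level M).DY,
          sTheta := CycEnvelope.muConjClass (T.level M).augY (T.chi M)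
            ((T.level M).sTheta (hη M)).range,
          sAlg := CycEnvelope.muConjClass (T.level M).augY (T.chi M) (T.twistedAlg M (hc M)).range }
        { Pi := (T.level M).env, D := (T.level M).DY,
          sTheta := CycEnvelope.muConjClass (T.level M).augY (T.chi M)
            (T.sectionOf M (η M * (c M ∘ T.aug ∘ T.PiYdd.subtype))
              (T.isEnvCocycle_mul_inflate M (T.isCocycle M (η M) (hη M)) (hc M))).range,
          sAlg := CycEnvelope.muConjClass (T.level M).augY (T.chi M) (T.level M).sAlg.range },
      ∀ (M M' : E) (h : (M : ℕ+) ∣ M') (x : (T.level M').env),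
        T.redEnv M M' h ((α M').e x) = (α M).e (T.redEnv M M' h x)

end ThetaEnvTower

end Literature.AnabelianGeometry.EtaleTheta
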